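import Summits.BirchSwinnertonDyer.Rank1Residual.GaloisImage.KuriharaLowerBoundThreeOfKolyvaginProduct
import Summits.BirchSwinnertonDyer.Rank1Residual.GaloisImage.KatoKuriharaPortThreeWith
import Summits.BirchSwinnertonDyer.Rank1Residual.GaloisImage.KuriharaLowerBoundThreeOfTransportAt
import HarnessLib

/-!
# P-KEYED twin of `KuriharaLowerBoundThreeOfKolyvaginProduct` — the two-level dictionary hypothesis `hdict` AT ONE PARAMETRISATION DATUM `P`
# (cell `b2b-bsdres`, team n1011; T-PORT-FIX (lead R5-112 (a) / R5-113 (a), joint text (ii-b)): the repaired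
# port PORT″ `KatoKuriharaPortThreeAtWith₂ W t v₃ η P` unpacks to `KatoKuriharaDictionaryThreeAt₂At … P`, so the
# lower-bound chain below the record corollary is re-keyed by ONE binder; seat p03 GEN 13 — BANKED bytes
# offered to the T-PORT-FIX owner n1011-p18, filed only on the owner's / lead's word)

HONEST FRAMING (cell `b2b-bsdres`, run/shared/lean/b2b/bsd-rank1-residual/, verbatim in every
file): the goal of the cell is to DELETE the COMBINATION-SHAPED residual classes of the
Birch–Swinnerton-Dyer formula for ALL analytic-rank `≤ 1` elliptic curves over `ℚ` — "full BSD
formula for every rank `≤ 1` curve in class `C`" assembled STRICTLY from published theorems — so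
that the rank-`≤ 1` remainder becomes exactly the CONSTRUCTION-SHAPED classes, which are TYPED
(missing-input `Prop`s), NOT attempted. This is not "finishing BSD". Team n1011 (N10/N11, the
additive block `X4 ∧ p = 3`): research route; no claim beyond the stated classes; the label X4 and
the mark of RESIDUAL-MAP §I N11 are UNCHANGED by this file; nothing is booked.  TOOL theorems only
(no definition, no named fact); CONDITIONAL exactly as `KuriharaLowerBoundThreeOfKolyvaginProduct.lean` EXCEPT that the two-level
dictionary hypothesis is the `P`-keyed `KatoKuriharaDictionaryThreeAt₂At W t k k′ D D′ red v₃ P`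
(n1011-p18's PORT″ append to `GaloisImage/KatoKuriharaPortThreeWith.lean`, joint text of lead R5-112 (a)):
binder diff EXACTLY {{`hdict : … KatoKuriharaDictionaryThreeAt₂ … v₃`}} ↦
{{`hdict : … KatoKuriharaDictionaryThreeAt₂At … v₃ P`}} at the theorem's own `P` (which already precedes
`hdict` in the signature); the ONE application `hdict … hv₃ P hcP hper` loses its `P`; every call into the
chain is re-pointed to the `_at` twin below; every other token is the original.  WHY: the universal-closure
PORT was shown UNSATISFIABLE on its population (n1011-p11 GEN 11, T-PORT-NEG p326481; r1 GEN 47 / referee-1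
GEN 48 CONFIRMED); the repair displays ONE generator family `η` AND keys the dictionary at the record's own
parametrisation datum `P` so that its NAMED DISCHARGER (★ PK-6₂) reaches it with no lemma the tree lacks
(DESIGN CRITERION OF RECORD, R5-112 (a)).  The original `∀ P` theorems stay (parents: `….at P`).

References: as `KuriharaLowerBoundThreeOfKolyvaginProduct.lean`; cells/n1011/PLAN.md R5-110 / R5-112 / R5-113; ROUTE-1.md §59–§60.
-/

noncomputable section

open scoped Classical NumberField ContRepresentation
open Function Field NumberField IsDedekindDomain IsDedekindDomain.HeightOneSpectrum WeierstrassCurve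
  Literature.NumberTheory.EllipticCurves Literature.NumberTheory.EllipticCurves.ModularForms
  Literature.NumberTheory.EllipticCurves.Rank1Residual
  Literature.NumberTheory.GaloisRepresentations
  Literature.NumberTheory.GaloisRepresentations.DiscreteGaloisModule Literature.NumberTheory.GaloisCohomology

namespace Summit.BirchSwinnertonDyer.Rank1Residual.GaloisImage.Assembly

/-- **P-KEYED twin of `padicValRat_le_of_kolyvaginProduct` (T-PORT-FIX, joint text (ii-b) of lead R5-112 (a) / R5-113 (a)):** binder diff EXACTLY {`hdict : … KatoKuriharaDictionaryThreeAt₂ … v₃`} ↦ {`hdict : … KatoKuriharaDictionaryThreeAt₂At … v₃ P`} at this theorem's own `P`; conclusion and every other binder identical; the original docstring follows verbatim.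
**(C20) at `p = 3` in Kim's ℕ-currency — R23_endshape's conclusion from a certificate at a
square-free product `n` of Kolyvagin primes** (module docstring).  Beyond the typed inputs of
`padicValRat_le_of_certificate_of_transport_at`: the shallow datum is a `τ`-datum
(`D.primes = frobeniusClassPrimes ρ S τ 3^{k+1}`, `τ ∈ Γ_{ℚ(μ)}` with (H.2)), `ρ_{E,3^{k+1}}` is
onto, `n ∈ 𝒩_{k+1}` (Kim) with the cyclicity flag at its primes (reduction of the local minimal
model) and `ℓ ∤ N` for `ℓ ∣ n`, ONE system `ψ` of surjective discrete logarithms, `δ̃^{(j)}_n(ψ) ≠ 0`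
and `δ̃^{(j)}_d(ψ) = 0` for `1 < d < n`, `d ∣ n`.  (B6): on `t = 1` rows supply
`D ⊆ 𝒫_{k+1+t}`, `D′ ⊆ 𝒫_{k′+1+t}`.
[cite: Kim2022StructureSelmer, Thm. 1.9 (6), §1.2.2 and §1.4.3] [cite: Sakamoto2024, §2 and Thm. 4.4]
[cite: MazurRubin2004, Thm. 3.2.4, Thm. 4.4.1 and App. A (33)] -/
theorem padicValRat_le_of_kolyvaginProduct_at
    (W : WeierstrassCurve ℚ) [W.IsElliptic] [W.IsGloballyMinimal] (t k : ℕ)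
    (D : KolyvaginDatum (W.torsionGaloisModule (((3 : ℕ) : ℤ) ^ k * ((3 : ℕ) : ℤ))))
    (v₃ : HeightOneSpectrum (𝓞 ℚ)) (hv₃ : ((3 : ℕ) : 𝓞 ℚ) ∈ v₃.asIdeal)
    -- the row
    (hadd : Addv W 3) (hc3 : ¬ 3 ∣ (W.baseChange ℚ_[3]).localTamagawaNumber ℤ_[3])
    (hsurj : W.HasSurjectiveModNGaloisRep ((3 : ℕ) : ℤ))
    (ht : Nat.card {Q : (W.baseChange ℚ_[3]).toAffine.Point // (3 : ℕ) • Q = 0} = 3 ^ t)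
    (hL : W.entireLFunction 1 ≠ 0) [Finite W.toAffine.Point] [Finite W.sha]
    {N : ℕ} [NeZero N] (P : ModularParametrizationData W N) (hcP : ¬ ((3 : ℕ) : ℤ) ∣ P.maninConstant)
    (hper : ∃ u : ℚ, ‖(u : ℚ_[3])‖ = 1 ∧ W.realPeriodRat = u * plusPeriod P.f)
    -- the shallow datum: cyclotomic transverse condition, a generator `g` of `KS₁`, and Sakamoto's
    -- Thm. 4.4 (2) in ORDER form at every level (R1-22 instance)
    (hDT : D.transverse = cyclotomicTransverse _)
    (g : Finset (HeightOneSpectrum (𝓞 ℚ)) →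
      galoisCohomology (W.torsionGaloisModule (((3 : ℕ) : ℤ) ^ k * ((3 : ℕ) : ℤ))) 1)
    (hg : g ∈ D.kolyvaginSystems (propagatedSelmerStructure W 3 k))
    (hgen : ∀ κ ∈ D.kolyvaginSystems (propagatedSelmerStructure W 3 k), ∃ a : ℕ, κ = a • g)
    -- the deep inputs, at every depth `k′`
    (D' : ∀ k' : ℕ, KolyvaginDatum (W.torsionGaloisModule (((3 : ℕ) : ℤ) ^ k' * ((3 : ℕ) : ℤ))))
    (hDT' : ∀ k', (D' k').transverse = cyclotomicTransverse _)
    (hPP' : ∀ k', (D' k').primes ⊆ D.primes)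
    (red : ∀ k' : ℕ, (W.torsionGaloisModule (((3 : ℕ) : ℤ) ^ k' * ((3 : ℕ) : ℤ))).toContRepresentation
      →ⁱL (W.torsionGaloisModule (((3 : ℕ) : ℤ) ^ k * ((3 : ℕ) : ℤ))).toContRepresentation)
    (hred : ∀ k', ∀ x : geomTorsion W (((3 : ℕ) : ℤ) ^ k' * ((3 : ℕ) : ℤ)),
      ((red k' x : geomTorsion W (((3 : ℕ) : ℤ) ^ k * ((3 : ℕ) : ℤ))) : geomPoints W) =
        (((3 : ℕ) : ℤ) ^ (k' - k)) • (x : geomPoints W))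
    (hdict : ∀ k', k ≤ k' → KatoKuriharaDictionaryThreeAt₂At W t k k' D (D' k') (red k') v₃ P)
    (g' : ∀ k' : ℕ, Finset (HeightOneSpectrum (𝓞 ℚ)) →
      galoisCohomology (W.torsionGaloisModule (((3 : ℕ) : ℤ) ^ k' * ((3 : ℕ) : ℤ))) 1)
    (hg' : ∀ k', g' k' ∈ (D' k').kolyvaginSystems (propagatedSelmerStructure W 3 k'))
    (hgo' : ∀ k', addOrderOf (g' k') = 3 ^ (k' + 1))
    (hgen' : ∀ k', ∀ κ ∈ (D' k').kolyvaginSystems (propagatedSelmerStructure W 3 k'),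
      ∃ a : ℕ, κ = a • g' k')
    (inv' : ∀ k' : ℕ, LocalInvariants ℚ (3 ^ (k' + 1))) (hperf' : ∀ k', (inv' k').IsPerfect)
    (hsum' : ∀ k', (inv' k').SumLocalTermEqZero) (hcompl' : ∀ k', (inv' k').SelmerComplement)
    (hinj' : ∀ k', ∀ v : HeightOneSpectrum (𝓞 ℚ), Injective (inv' k' (Sum.inr v)))
    (hEP : ∀ v : HeightOneSpectrum (𝓞 ℚ), localEulerPoincareCharacteristic (v.adicCompletion ℚ))
    (T : ∀ k' : ℕ, Finset (HeightOneSpectrum (𝓞 ℚ))) (hv₃T : ∀ k', v₃ ∈ T k')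
    (hT : ∀ k', ∀ v : HeightOneSpectrum (𝓞 ℚ), v ∉ T k' →
      (((3 ^ (k' + 1) : ℕ) : ℕ) : 𝓞 ℚ) ∉ v.asIdeal ∧
        GaloisRep.IsUnramifiedAt v (W.torsionGaloisModule (((3 : ℕ) : ℤ) ^ k' * ((3 : ℕ) : ℤ))))
    (h𝓕T : ∀ k', (propagatedSelmerStructure W 3 k').IsUnramifiedOutside (finSupport (T k')))
    (h𝓚T : ∀ k', (W.kummerSelmerStructure (((3 : ℕ) : ℤ) ^ k' * ((3 : ℕ) : ℤ))).IsUnramifiedOutside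
      (finSupport (T k')))
    (hfinT : ∀ k', Finite (geomTorsion W (((3 : ℕ) : ℤ) ^ k' * ((3 : ℕ) : ℤ))))
    (hfinS : ∀ k', Finite (W.kummerSelmerStructure (((3 : ℕ) : ℤ) ^ k' * ((3 : ℕ) : ℤ))).selmerGroup)
    -- the primes of the data lie off the admissible sets and have Rubin's local shape
    (hPS : ∀ q ∈ D.primes, q ∉ T k) (hPS' : ∀ k', ∀ q ∈ (D' k').primes, q ∉ T k')
    (hUT : ∀ q ∈ D.primes,
      Nat.card (unramifiedSubgroup (GaloisRep.toLocal q
        (W.torsionGaloisModule (((3 : ℕ) : ℤ) ^ k * ((3 : ℕ) : ℤ)))) 1) =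
        Nat.card (D.transverse (Sum.inr q)))
    (hUT' : ∀ k', ∀ q ∈ (D' k').primes,
      Nat.card (unramifiedSubgroup (GaloisRep.toLocal q
        (W.torsionGaloisModule (((3 : ℕ) : ℤ) ^ k' * ((3 : ℕ) : ℤ)))) 1) =
        Nat.card ((D' k').transverse (Sum.inr q)))
    -- Sakamoto's Thm. 4.4 (2) in ORDER form at every level, shallow and deep (R1-22 / S24-DEEP)
    (hR22D : ∀ d, D.IsLevel d →
      (Nat.card ((inv' k).dualSelmerStructure _
          (D.atLevel (propagatedSelmerStructure W 3 k) d)).selmerGroup ∣ 3 ^ (k + 1) →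
        addOrderOf (g d) * Nat.card ((inv' k).dualSelmerStructure _
          (D.atLevel (propagatedSelmerStructure W 3 k) d)).selmerGroup = 3 ^ (k + 1)) ∧
      (3 ^ (k + 1) ∣ Nat.card ((inv' k).dualSelmerStructure _
          (D.atLevel (propagatedSelmerStructure W 3 k) d)).selmerGroup → g d = 0))
    (hR22' : ∀ k' d, (D' k').IsLevel d →
      (Nat.card ((inv' k').dualSelmerStructure _
          ((D' k').atLevel (propagatedSelmerStructure W 3 k') d)).selmerGroup ∣ 3 ^ (k' + 1) →
        addOrderOf (g' k' d) * Nat.card ((inv' k').dualSelmerStructure _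
          ((D' k').atLevel (propagatedSelmerStructure W 3 k') d)).selmerGroup = 3 ^ (k' + 1)) ∧
      (3 ^ (k' + 1) ∣ Nat.card ((inv' k').dualSelmerStructure _
          ((D' k').atLevel (propagatedSelmerStructure W 3 k') d)).selmerGroup → g' k' d = 0))
    -- the shallow datum is a `τ`-datum at level `3^{k+1}`, and `ρ_{E,3^{k+1}}` is onto
    {S : Set (HeightOneSpectrum (𝓞 ℚ))} {τ : absoluteGaloisGroup ℚ}
    (hτμ : τ ∈ rootsOfUnityFixer ℚ (3 ^ (k + 1)))
    (hτq : Nonempty (cokerSubOne (W.torsionGaloisModule (((3 : ℕ) : ℤ) ^ k * ((3 : ℕ) : ℤ))) τ ≃+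
      ZMod (3 ^ (k + 1))))
    (hDP : D.primes = frobeniusClassPrimes
      (W.torsionGaloisModule (((3 : ℕ) : ℤ) ^ k * ((3 : ℕ) : ℤ))) S τ (3 ^ (k + 1)))
    (hsurjK : W.HasSurjectiveModNGaloisRep (((3 : ℕ) : ℤ) ^ k * ((3 : ℕ) : ℤ)))
    -- the certificate in Kim's currency
    (n : ℕ) [NeZero n] (hn : Kato.IsKolyvaginProduct W 3 (k + 1) n)
    (hflag : ∀ v : HeightOneSpectrum (𝓞 ℚ), Ideal.absNorm v.asIdeal ∣ n →
      Nat.card (AddSubgroup.torsionBy (W.reductionAt v).toAffine.Point (3 : ℕ)) ≤ 3)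
    (hnS : ∀ v : HeightOneSpectrum (𝓞 ℚ), Ideal.absNorm v.asIdeal ∣ n → v ∉ S)
    (hnN : ∀ ℓ ∈ n.primeFactors, ¬ ℓ ∣ N) {j : ℕ} (htj : t + j ≤ k + 1)
    (ψ : (ℓ : ℕ) → (ZMod ℓ)ˣ →* Multiplicative (ZMod (3 ^ j)))
    (hψ : ∀ ℓ ∈ n.primeFactors, Function.Surjective (ψ ℓ))
    (hcert : kuriharaNumber P.f (3 ^ j) n ψ ≠ 0)
    (hv : ∀ d : ℕ, d ∣ n → 1 < d → d < n → ∀ [NeZero d], kuriharaNumber P.f (3 ^ j) d ψ = 0) :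
    ∃ q : ℚ, W.entireLFunction 1 / (W.realPeriodRat : ℂ) = (q : ℂ) ∧
      padicValRat 3 q ≤
        (padicValNat 3 (Nat.card (AddCommGroup.primaryComponent W.sha 3)) : ℤ) + ((j - 1 : ℕ) : ℤ) := by
  haveI : Fact (Nat.Prime 3) := ⟨Nat.prime_three⟩
  -- the places of `n` form a level of `D`
  obtain ⟨nF, hsub, hprod, hmem⟩ := FrobShape.exists_level_of_kolyvaginProduct W 3
    (Nat.succ_pos k) hn hflag (((3 : ℕ) : ℤ) ^ k * ((3 : ℕ) : ℤ)) (by push_cast; rw [pow_succ]) hsurjK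
    hτμ hτq hnS
  have hlev : D.IsLevel nF := by
    change (↑nF : Set _) ⊆ D.primes
    rw [hDP]
    exact hsub
  have hprime : ∀ q ∈ nF, (Ideal.absNorm q.asIdeal).Prime := fun q hq =>
    Nat.prime_of_mem_primeFactors (hmem q hq)
  have hinj := absNorm_injOn (↑nF : Set (HeightOneSpectrum (𝓞 ℚ)))
  have hn0 : n ≠ 0 := hn.ne_zero
  -- sub-products are divisors of `n`
  have hdvd : ∀ c ⊆ nF, (∏ q ∈ c, Ideal.absNorm q.asIdeal) ∣ n := fun c hc => by
    rw [← hprod]; exact Finset.prod_dvd_prod_of_subset _ _ _ hc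
  refine padicValRat_le_of_certificate_of_transport_at W t k D v₃ hv₃ hadd hc3 hsurj ht hL P hcP hper
    hDT g hg hgen D' hDT' hPP' red hred hdict g' hg' hgo' hgen' inv' hperf' hsum' hcompl' hinj' hEP
    T hv₃T hT h𝓕T h𝓚T hfinT hfinS hPS hPS' hUT hUT' hR22D hR22' nF hlev htj ?_ (ψ₀ := ψ) ?_ ?_ ?_
  · -- `N q ∤ N`
    intro q hq
    exact (Nat.Prime.coprime_iff_not_dvd (hprime q hq)).mpr (hnN _ (hmem q hq))
  · exact fun q hq => hψ _ (hmem q hq)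
  · -- the certificate at `n = ∏ N q`
    rw [kuriharaNumber_congr_level P.f (3 ^ j) hprod _ inferInstance ψ]
    exact hcert
  · -- the proper non-empty sub-levels: proper divisors `1 < d < n`, any surjective `ψ′`
    intro c hc hne ψ' hψ'
    set d := ∏ q ∈ c, Ideal.absNorm q.asIdeal with hd
    have hd0 : d ≠ 0 := Finset.prod_ne_zero_iff.2 fun q _ => absNorm_ne_zero q
    haveI : NeZero d := ⟨hd0⟩
    have hdn : d ∣ n := hdvd c hc.subset
    have h1d : 1 < d := by
      obtain ⟨q₀, hq₀⟩ := hne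
      have hle : Ideal.absNorm q₀.asIdeal ≤ d :=
        Nat.le_of_dvd (Nat.pos_of_ne_zero hd0) (Finset.dvd_prod_of_mem _ hq₀)
      exact lt_of_lt_of_le (hprime q₀ (hc.subset hq₀)).one_lt hle
    have hdlt : d < n := by
      have hsd : (nF \ c).Nonempty := Finset.sdiff_nonempty.mpr hc.not_subset
      obtain ⟨q₁, hq₁⟩ := hsd
      have hsplit := Finset.prod_sdiff (f := fun q => Ideal.absNorm q.asIdeal) hc.subset
      rw [hprod] at hsplit
      have h1 : 1 < ∏ q ∈ nF \ c, Ideal.absNorm q.asIdeal := by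
        have hle : Ideal.absNorm q₁.asIdeal ≤ ∏ q ∈ nF \ c, Ideal.absNorm q.asIdeal :=
          Nat.le_of_dvd (Nat.pos_of_ne_zero (Finset.prod_ne_zero_iff.2 fun q _ => absNorm_ne_zero q))
            (Finset.dvd_prod_of_mem _ hq₁)
        exact lt_of_lt_of_le (hprime q₁ (Finset.sdiff_subset hq₁)).one_lt hle
      calc d = 1 * d := (one_mul d).symm
        _ < (∏ q ∈ nF \ c, Ideal.absNorm q.asIdeal) * d := Nat.mul_lt_mul_of_pos_right h1
            (Nat.pos_of_ne_zero hd0)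
        _ = n := hsplit
    have hzero : kuriharaNumber P.f (3 ^ j) d ψ = 0 := hv d hdn h1d hdlt
    -- `δ̃_d(ψ′) = u · δ̃_d(ψ)` for a unit `u`
    have hψd : ∀ ℓ ∈ d.primeFactors, Function.Surjective (ψ ℓ) := fun ℓ hℓ =>
      hψ ℓ (Nat.primeFactors_mono hdn hn0 hℓ)
    have hψ'd : ∀ ℓ ∈ d.primeFactors, Function.Surjective (ψ' ℓ) :=
      Shallow.forall_primeFactors_of_forall_mem (fun q : HeightOneSpectrum (𝓞 ℚ) =>
        Ideal.absNorm q.asIdeal) c (fun q hq => hprime q (hc.subset hq)) (hinj.mono hc.subset) hψ'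
    obtain ⟨u, hu⟩ := exists_units_kuriharaNumber_eq_mul P.f (3 ^ j) d hψd hψ'd
    change kuriharaNumber P.f (3 ^ j) d ψ' = 0
    rw [hu, hzero, mul_zero]

end Summit.BirchSwinnertonDyer.Rank1Residual.GaloisImage.Assembly

end
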